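import Mathlib
import HarnessLib
import Literature.Computability.AlgebraicComplexity.SymmetricArithCircuit
import Literature.Computability.AlgebraicComplexity.DawarWilsenach2025Proofs
import Literature.GroupTheory.PermutationGroups.SmallIndexSubgroups

/-!
# ValiantsHypothesis / MonotoneRestoration — `MonotoneRestorationQP`, line `Sketch`, stub G1

Support file for crux item `stmt-ValiantsHypothesis-15886`
(`Summit.ValiantsHypothesis.ValiantsHypothesis.Theses.MonotoneRestoration.MonotoneRestorationQP`),
line `Sketch`, stub `stub_gateSupport` (the support theorem in gate-stabiliser form).

In a `Sym_n`-symmetric labelled arithmetic circuit `C` (Dawar–Wilsenach Def. 3.7, unbundled: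
`LabelledArithCircuit.IsSymmetric`) on the `n × n` matrix of variables with fewer than `C(n, k)`
gates (`n > 8`, `1 ≤ k`, `4 k ≤ n`), every gate `g` has a set `X` of fewer than `k` indices such
that every EVEN permutation fixing `X` pointwise extends to a circuit automorphism fixing `g`.

Proof: the permutations `ρ` admitting an extension `π` (`C.IsAutomorphismExtending ρ π`) with
`π g = g` form a subgroup `S ≤ Sym_n` (`isAutomorphismExtending_one`, `.inv`, `.trans`). Choosing
for every `ρ` an extension `π_ρ` (symmetry), `ρ S ↦ π_ρ g` is a well-defined injection of the left
cosets into the gates (`π_{ρ₁} g = π_{ρ₂} g` gives the extension `π_{ρ₁}⁻¹ π_{ρ₂}` of `ρ₁⁻¹ ρ₂`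
fixing `g`), so `[Sym_n : S] ≤ |G| < C(n, k)`, and Dixon–Mortimer 5.2B
(`alternating_fixing_le_of_index_lt_choose`) supplies `X`.
-/

-- `Summit.ValiantsHypothesis.ValiantsHypothesis.…` is the tree's mandated single-conjunct layout
-- (Sub = Summit), so the duplicated namespace component is intended.
set_option linter.dupNamespace false

noncomputable section

namespace Summit.ValiantsHypothesis.ValiantsHypothesis.Theorems

open Literature.Computability.AlgebraicComplexity

/-- **Index of a gate stabiliser.** In a `Γ`-symmetric labelled circuit, the subgroup of those
`γ ∈ Γ` that extend to an automorphism fixing the gate `g` has index at most the number of gates: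
choosing extensions `π_γ` (symmetry), the map `γ S ↦ π_γ g` on left cosets is injective
(orbit–stabiliser counting). [folklore] -/
theorem gateSupport_index_le_card {K X Y G : Type*} [Fintype G] {Γ : Type*} [Group Γ]
    [MulAction Γ X] [MulAction Γ Y] (C : LabelledArithCircuit K X Y G) (hC : C.IsSymmetric Γ)
    (g : G) (S : Subgroup Γ)
    (hS : ∀ γ : Γ, γ ∈ S ↔ ∃ π : Equiv.Perm G, C.IsAutomorphismExtending γ π ∧ π g = g) :
    S.index ≤ Fintype.card G := by
  choose π hπ using hC
  let f : Γ ⧸ S → G := fun q => π q.out g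
  have hf : Function.Injective f := by
    intro a b hab
    change π a.out g = π b.out g at hab
    rw [← QuotientGroup.out_eq' a, ← QuotientGroup.out_eq' b, QuotientGroup.eq, hS]
    refine ⟨(π a.out)⁻¹ * π b.out, (hπ b.out).trans (hπ a.out).inv, ?_⟩
    rw [Equiv.Perm.mul_apply, ← hab, Equiv.Perm.inv_eq_iff_eq]
  rw [← Nat.card_eq_fintype_card]
  exact Nat.card_le_card_of_injective f hf

/-- **G1 — support theorem, gate-stabiliser form.** In a `Sym_n`-symmetric labelled circuit
with fewer than `C(n,k)` gates (`n > 8`, `1 ≤ k`, `4k ≤ n`), every gate `g` admits a set `X` of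
fewer than `k` indices such that every EVEN permutation fixing `X` pointwise extends to an
automorphism fixing `g` (the subgroup of permutations having an extension fixing `g` has index
`≤ |G| < C(n,k)`: automorphisms compose and invert, `isAutomorphismExtending_one/inv/trans`; then
Dixon–Mortimer 5.2B `alternating_fixing_le_of_index_lt_choose`). [cite: DawarWilsenach2025, §6 (support theorem); DixonMortimer1996, Thm 5.2B] -/
theorem stub_gateSupport {n : ℕ} {K : Type} {G : Type} [Fintype G]
    (C : LabelledArithCircuit K (Fin n × Fin n) Unit G) (hC : C.IsSymmetric (Equiv.Perm (Fin n)))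
    {k : ℕ} (hn : 8 < n) (hk : 1 ≤ k) (h4k : 4 * k ≤ n) (hcard : Fintype.card G < n.choose k)
    (g : G) :
    ∃ X : Finset (Fin n), X.card < k ∧ ∀ ρ : Equiv.Perm (Fin n), (∀ x ∈ X, ρ x = x) →
      Equiv.Perm.sign ρ = 1 → ∃ π : Equiv.Perm G, C.IsAutomorphismExtending ρ π ∧ π g = g := by
  -- the "stabiliser" of `g`: permutations with an extension fixing `g`
  let S : Subgroup (Equiv.Perm (Fin n)) :=
    { carrier := {ρ | ∃ π : Equiv.Perm G, C.IsAutomorphismExtending ρ π ∧ π g = g}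
      mul_mem' := by
        rintro a b ⟨πa, ha, hag⟩ ⟨πb, hb, hbg⟩
        exact ⟨πa * πb, hb.trans ha, by rw [Equiv.Perm.mul_apply, hbg, hag]⟩
      one_mem' := ⟨1, C.isAutomorphismExtending_one, rfl⟩
      inv_mem' := by
        rintro a ⟨πa, ha, hag⟩
        exact ⟨πa⁻¹, ha.inv, by rw [Equiv.Perm.inv_eq_iff_eq, hag]⟩ }
  have hS : ∀ ρ : Equiv.Perm (Fin n),
      ρ ∈ S ↔ ∃ π : Equiv.Perm G, C.IsAutomorphismExtending ρ π ∧ π g = g := fun ρ => Iff.rfl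
  have hidx : S.index < (Fintype.card (Fin n)).choose k := by
    rw [Fintype.card_fin]
    exact (gateSupport_index_le_card C hC g S hS).trans_lt hcard
  obtain ⟨X, hXk, hX⟩ :=
    Literature.GroupTheory.PermutationGroups.alternating_fixing_le_of_index_lt_choose S k
      (by rwa [Fintype.card_fin]) hk (by rwa [Fintype.card_fin]) hidx
  exact ⟨X, hXk, fun ρ hρ hsign => (hS ρ).1 (hX ρ hρ hsign)⟩

end Summit.ValiantsHypothesis.ValiantsHypothesis.Theorems

end
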